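import Mathlib
import Literature.Algebra.Polynomial.SparsePutinarPositivstellensatz
import HarnessLib

/-!
# Correlative sparsity: from the csp graph and a chordal extension to block-structured Putinar
# certificates (Waki–Kim–Kojima–Muramatsu 2006 §3.2–3.3, §4.1; Lasserre 2006 (1.3)–(1.4),
# (3.1)–(3.2), Corollary 3.9)

Topic `Literature/Algebra/Polynomial`, namespace
`Literature.Algebra.Polynomial.CorrelativeSparsityCertificates`.  The glue between the tree's
chordal-graph files (`IsChordal.exists_runningIntersection_maximalCliques`: the maximal cliques of
a chordal graph enumerate with the running intersection property) and
`SparsePutinarPositivstellensatz.sparse_putinar` (Lasserre 2006 Cor. 3.9 / Grimm–Netzer–Schweighofer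
2007): the correlative sparsity pattern graph of a polynomial optimisation problem, the block
structure read off a chordal extension, and the resulting block-structured certificate with the
redundant ball constraints `N − ‖x(I_k)‖² ≥ 0` of Lasserre's (3.1).

## Sources, read on the page

* H. Waki, S. Kim, M. Kojima, M. Muramatsu, *Sums of squares and semidefinite program relaxations
  for polynomial optimization problems with structured sparsity*, SIAM J. Optim. 17 (2006) 218–242
  [held text `paper:doi-10-1137-050623802`]: p. 222 §3.2 «correlative sparsity pattern matrix …
  `R_{ij} = ⋆` if `i = j`, `⋆` if `α_i ≥ 1` and `α_j ≥ 1` for some `α ∈ F₀ = supp(f₀)`, `0`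
  otherwise»; §3.3 «the undirected graph `G(N, E)` with `N = {1,…,n}` and
  `E = {{i,j} : i, j ∈ N, i < j, R_{ij} = ⋆}` is called the correlative sparsity pattern graph (csp
  graph). Let `C_1,…,C_p ⊂ N` denote the maximal cliques of the csp graph … we generate a chordal
  extension `G(N, E′)` of the csp graph `G(N,E)` and use the extended csp graph instead»; p. 224
  §4.1 «Let `F_k = {i : α_i ≥ 1 for some α ∈ supp(f_k)}` … `R_{ij} = ⋆` if `i ∈ F_k` and
  `j ∈ F_k` for some `k ∈ {1,…,m}`» (constrained case).
* J. B. Lasserre, *Convergent SDP-relaxations in polynomial optimization with sparsity*, SIAM J.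
  Optim. 17 (2006) 822–843 [held text `paper:doi-10-1137-05064504x`]: p. 3 «Every polynomial `g_j`
  in the definition (1.2) of `K`, is only concerned with variables `{X_i | i ∈ I_k}` for some `k`.
  Next, `f ∈ ℝ[X]` can be written `f = f_1 + ⋯ + f_p` where each `f_k` uses only variables
  `{X_i | i ∈ I_k}` … If `I_1,…,I_p` are the maximal cliques of a chordal graph then (1.3) is
  satisfied possibly after some reordering of the cliques, and is known as the running intersection
  property»; p. 11 Corollary 3.9 «Let `K` be as in (3.2) with the additional quadratic constraints
  (3.1) … If `f` is strictly positive on `K` then `f = Σ_{k=1}^p (q_k + Σ_{j∈J_k} q_{jk} g_j)` for some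
  s.o.s. polynomials `q_k, q_{jk} ∈ ℝ[X(I_k)]`» with (3.1) the redundant constraints
  `M − ‖X(I_k)‖² ≥ 0`, `k = 1,…,p`, and `J_k` the constraints involving only the variables `X(I_k)`.

## What is formalised (all proved; no named facts)

* §1 `cspGraph f g` — the csp graph of `(f, (g_k))` (Waki §4.1: `i ~ j` iff `x_i x_j` divide a common
  monomial of `f`, or `i, j ∈ F_k = vars(g_k)` for one `k`); the supports of the monomials of `f`
  and the sets `vars(g_k)` are cliques (`isClique_monomialSupport`, `isClique_vars`).
* §2 block covers: `IsBlockCover f g I` (every monomial of `f` and every `vars(g_k)` lies in one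
  block), `IsBlockCover.of_cliques` (any family of vertex sets of a supergraph of the csp graph
  containing every clique, e.g. all maximal cliques of a chordal extension, is a block cover) and
  ★ `IsBlockCover.exists_sum_eq` — Lasserre's «`f = f_1 + ⋯ + f_p`, `f_k ∈ ℝ[X(I_k)]`» and
  `g_j ∈ ℝ[X(I_k)]` for some `k`.
* §3 `exists_maximalCliques_runningIntersection` — the maximal cliques of a chordal graph on a
  finite vertex type as `I : Fin p → Finset σ` with the tree's `IndexedRunningIntersection`.
* §4 `IsBlockSos I s` («s.o.s. polynomial in `ℝ[X(I)]`»: `s = rename q`, `q` a sum of squares of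
  `MvPolynomial ↥I ℝ`) and ★★ `sparse_putinar_of_blockCover` — **Lasserre's Corollary 3.9 in its
  native form**: blocks `I : Fin p → Finset σ` (non-empty, (RIP)), `f = Σ_j f_j` with
  `f_j ∈ ℝ[X(I_j)]`, every `g_k` in some `ℝ[X(I_j)]`, `N ∈ ℝ`, and
  `f > 0` on `{x | g_k(x) ≥ 0 ∀k, ‖x(I_j)‖² ≤ N ∀j}` ⇒
  `f = Σ_j (s₀_j + Σ_{k : g_k ∈ ℝ[X(I_j)]} s_{jk} g_k + t_j (N − ‖X(I_j)‖²))` with `s₀_j, s_{jk}, t_j`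
  s.o.s. in `ℝ[X(I_j)]` (the block modules are archimedean BECAUSE of the ball constraints — no
  extra hypothesis).
* §5 ★★ `sparse_putinar_of_isChordal_csp` — **the Waki–Lasserre pipeline**: for any chordal graph
  `G ⊇ cspGraph f g` on a non-empty finite `σ` and `f > 0` on
  `{g ≥ 0} ∩ {‖x(K)‖² ≤ N for every maximal clique K of G}`, there are an enumeration
  `I : Fin p → Finset σ` of the maximal cliques of `G` with (RIP), a decomposition `f = Σ_j f_j`,
  and the block certificate of §4.

Not here: how to compute a (minimum) chordal extension (Waki §3.3's heuristics), the sizes of the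
resulting SDP blocks, Lasserre's Theorems 3.6/3.7.

## References

* [WakiEtAl2006] H. Waki, S. Kim, M. Kojima, M. Muramatsu, SIAM J. Optim. 17 (2006) 218–242,
  doi:10.1137/050623802 — §3.2–3.3 (p. 222) csp matrix / csp graph / maximal cliques of a chordal
  extension, §4.1 (p. 224) constrained csp matrix.
* [Lasserre2006] J. B. Lasserre, SIAM J. Optim. 17 (2006) 822–843, doi:10.1137/05064504X — p. 3
  (1.3) and the decomposition `f = Σ f_k`, p. 6 (3.1) (`g_{m+k} := n_k M² − ‖X(I_k)‖² ≥ 0`), p. 7 (3.2) / Remark 3.5 (ii), p. 11 Corollary 3.9.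
* [GrimmNetzerSchweighofer2007] (through `SparsePutinarPositivstellensatz.sparse_putinar`).
-/

noncomputable section

open MvPolynomial Finset

open scoped BigOperators

namespace Literature.Algebra.Polynomial.CorrelativeSparsityCertificates

open Literature.Algebra.Polynomial.PutinarPositivstellensatz
open Literature.Algebra.Polynomial.SparsePutinarPositivstellensatz
open Literature.Combinatorics.SimpleGraph (IndexedRunningIntersection RunningIntersection
  runningIntersection_ofFn_iff IsChordal)

variable {σ : Type*}

/-! ### §1 The correlative sparsity pattern graph -/

/-- **The csp graph** of the problem `min f s.t. g_k ≥ 0` [Waki–Kim–Kojima–Muramatsu §4.1]: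
vertices are the variables; `i ≠ j` are adjacent iff `α_i ≥ 1` and `α_j ≥ 1` for some
`α ∈ supp(f)`, or `i, j ∈ F_k := vars(g_k)` for some `k`.
[cite: WakiEtAl2006, §3.2–§3.3 (p. 222) and §4.1 (p. 224)] -/
def cspGraph {κ : Type*} (f : MvPolynomial σ ℝ) (g : κ → MvPolynomial σ ℝ) : SimpleGraph σ :=
  SimpleGraph.fromRel fun i j =>
    (∃ α ∈ f.support, α i ≠ 0 ∧ α j ≠ 0) ∨ ∃ k, i ∈ (g k).vars ∧ j ∈ (g k).vars

/-- The support `{i | α_i ≥ 1}` of a monomial of `f` is a clique of the csp graph.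
[cite: WakiEtAl2006, §3.2 (p. 222)] -/
theorem isClique_monomialSupport {κ : Type*} (f : MvPolynomial σ ℝ) (g : κ → MvPolynomial σ ℝ)
    {α : σ →₀ ℕ} (hα : α ∈ f.support) : (cspGraph f g).IsClique {i | α i ≠ 0} := by
  intro i hi j hj hij
  rw [cspGraph, SimpleGraph.fromRel_adj]
  exact ⟨hij, Or.inl (Or.inl ⟨α, hα, hi, hj⟩)⟩

/-- The variable set `F_k = vars(g_k)` of a constraint is a clique of the csp graph.
[cite: WakiEtAl2006, §4.1 (p. 224)] -/
theorem isClique_vars {κ : Type*} (f : MvPolynomial σ ℝ) (g : κ → MvPolynomial σ ℝ) (k : κ) :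
    (cspGraph f g).IsClique {i | i ∈ (g k).vars} := by
  intro i hi j hj hij
  rw [cspGraph, SimpleGraph.fromRel_adj]
  exact ⟨hij, Or.inl (Or.inr ⟨k, hi, hj⟩)⟩

/-! ### §2 Block covers and the decomposition `f = f_1 + ⋯ + f_p` -/

/-- A family of blocks `I_1,…,I_p ⊆ σ` COVERS the problem `(f, g)`: every monomial of `f` uses the
variables of one block and every constraint `g_k` uses the variables of one block («Every
polynomial `g_j` … is only concerned with variables `{X_i | i ∈ I_k}` for some `k`. Next, `f` can be
written `f = f_1 + ⋯ + f_p` where each `f_k` uses only variables `{X_i | i ∈ I_k}`»).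
[cite: Lasserre2006, §1 p. 3 (before (1.3))] -/
structure IsBlockCover {κ : Type*} {p : ℕ} (f : MvPolynomial σ ℝ) (g : κ → MvPolynomial σ ℝ)
    (I : Fin p → Finset σ) : Prop where
  /-- every monomial of `f` lies in a block -/
  mono : ∀ α ∈ f.support, ∃ j, ∀ i, α i ≠ 0 → i ∈ I j
  /-- every constraint lies in a block -/
  cons : ∀ k, ∃ j, (g k).vars ⊆ I j

/-- A family of vertex sets of a supergraph `G` of the csp graph which contains every clique of `G`
(e.g. ALL maximal cliques of a chordal extension `G`, Waki §3.3) is a block cover.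
[cite: WakiEtAl2006, §3.3 (p. 222)] -/
theorem IsBlockCover.of_cliques {κ : Type*} {p : ℕ} {f : MvPolynomial σ ℝ}
    {g : κ → MvPolynomial σ ℝ} {G : SimpleGraph σ} (hG : cspGraph f g ≤ G) {I : Fin p → Finset σ}
    (hI : ∀ K : Set σ, G.IsClique K → ∃ j, K ⊆ I j) : IsBlockCover f g I := by
  refine ⟨fun α hα => ?_, fun k => ?_⟩
  · obtain ⟨j, hj⟩ := hI _ ((isClique_monomialSupport f g hα).mono hG)
    exact ⟨j, fun i hi => hj hi⟩
  · obtain ⟨j, hj⟩ := hI _ ((isClique_vars f g k).mono hG)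
    exact ⟨j, fun i hi => hj hi⟩

/-- On a finite vertex type every clique lies in a maximal clique, so the family of ALL maximal
cliques of `G ⊇ csp` is a block cover. [cite: WakiEtAl2006, §3.3 (p. 222)] -/
theorem IsBlockCover.of_maximalCliques [Finite σ] {κ : Type*} {p : ℕ} {f : MvPolynomial σ ℝ}
    {g : κ → MvPolynomial σ ℝ} {G : SimpleGraph σ} (hG : cspGraph f g ≤ G) {I : Fin p → Finset σ}
    (hI : ∀ K : Set σ, Maximal G.IsClique K → ∃ j, (I j : Set σ) = K) : IsBlockCover f g I := by
  refine IsBlockCover.of_cliques hG fun K hK => ?_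
  obtain ⟨K', hKK', hmax⟩ := Finite.exists_le_maximal hK
  obtain ⟨j, hj⟩ := hI K' hmax
  exact ⟨j, fun i hi => by rw [hj]; exact hKK' hi⟩

/-- ★ **The decomposition** «`f = f_1 + ⋯ + f_p` where each `f_k` uses only variables
`{X_i | i ∈ I_k}`» and «every `g_j` is only concerned with variables `{X_i | i ∈ I_k}` for some
`k`», from a block cover (assign each monomial to one block containing it).
[cite: Lasserre2006, §1 p. 3 (before (1.3))] -/
theorem IsBlockCover.exists_sum_eq {κ : Type*} {p : ℕ} {f : MvPolynomial σ ℝ}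
    {g : κ → MvPolynomial σ ℝ} {I : Fin p → Finset σ} (h : IsBlockCover f g I) :
    (∃ fb : Fin p → MvPolynomial σ ℝ, (∀ j, fb j ∈ supported ℝ (I j : Set σ)) ∧ ∑ j, fb j = f) ∧
      ∀ k, ∃ j, g k ∈ supported ℝ (I j : Set σ) := by
  classical
  refine ⟨?_, fun k => ?_⟩
  · rcases isEmpty_or_nonempty (Fin p) with hp | hp
    · -- no blocks: then `f` has no monomials
      have hf0 : f = 0 := by
        ext α
        rw [coeff_zero]
        by_contra hne
        obtain ⟨j, -⟩ := h.mono α (mem_support_iff.mpr hne)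
        exact hp.elim j
      exact ⟨fun _ => 0, fun _ => Subalgebra.zero_mem _, by simp [hf0]⟩
    choose! blk hblk using h.mono
    refine ⟨fun j => ∑ α ∈ f.support with blk α = j, monomial α (coeff α f), fun j => ?_, ?_⟩
    · refine Subalgebra.sum_mem _ fun α hα => ?_
      rw [Finset.mem_filter] at hα
      rw [mem_supported, vars_monomial (mem_support_iff.mp hα.1)]
      intro i hi
      rw [Finset.mem_coe, Finsupp.mem_support_iff] at hi
      rw [Finset.mem_coe, ← hα.2]
      exact hblk α hα.1 i hi
    · rw [Finset.sum_fiberwise f.support blk fun α => monomial α (coeff α f)]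
      exact f.as_sum.symm
  · obtain ⟨j, hj⟩ := h.cons k
    exact ⟨j, by rw [mem_supported]; exact Finset.coe_subset.2 hj⟩

/-! ### §3 The maximal cliques of a chordal extension, with the running intersection property -/

/-- The maximal cliques of a chordal graph on a finite vertex type, enumerated as
`I_1,…,I_p` (finite sets) with the running intersection property (1.3) — the tree's
`IsChordal.exists_runningIntersection_maximalCliques`, re-indexed by `Fin p`.
[cite: Lasserre2006, §1 p. 3 (1.3) («If I_1,…,I_p are the maximal cliques of a chordal graph then (1.3) is satisfied possibly after some reordering»)] -/
theorem exists_maximalCliques_runningIntersection [Fintype σ] {G : SimpleGraph σ}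
    (hG : IsChordal G) :
    ∃ (p : ℕ) (I : Fin p → Finset σ), (∀ K : Set σ, Maximal G.IsClique K ↔ ∃ j, (I j : Set σ) = K) ∧
      IndexedRunningIntersection fun j => (I j : Set σ) := by
  classical
  obtain ⟨L, -, hmem, hrip, -⟩ := hG.exists_runningIntersection_maximalCliques
  refine ⟨L.length, fun j => (L.get j).toFinset, fun K => ?_, ?_⟩
  · rw [← hmem K]
    constructor
    · intro hK
      obtain ⟨j, hj⟩ := List.mem_iff_get.1 hK
      exact ⟨j, by rw [Set.coe_toFinset, hj]⟩
    · rintro ⟨j, rfl⟩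
      rw [Set.coe_toFinset]
      exact List.get_mem L j
  · have hfun : (fun j => ((L.get j).toFinset : Set σ)) = fun j => L.get j := by
      funext j
      rw [Set.coe_toFinset]
    rw [hfun, ← runningIntersection_ofFn_iff, List.ofFn_get]
    exact hrip

/-- Maximal cliques of a graph with a vertex are non-empty.
[cite: WakiEtAl2006, §3.3 (p. 222)] -/
theorem nonempty_of_maximal_isClique [Nonempty σ] {G : SimpleGraph σ} {K : Set σ}
    (hK : Maximal G.IsClique K) : K.Nonempty := by
  by_contra h
  rw [Set.not_nonempty_iff_eq_empty] at h
  subst h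
  obtain ⟨v⟩ := ‹Nonempty σ›
  have h1 : G.IsClique ({v} : Set σ) := Set.pairwise_singleton v _
  have h2 := hK.2 h1 (Set.empty_subset _)
  exact absurd (h2 (Set.mem_singleton v)) (Set.notMem_empty v)

/-! ### §4 Block sums of squares and Lasserre's Corollary 3.9 with the ball constraints (3.1) -/

/-- «s.o.s. polynomial in `ℝ[X(I)]`»: `s` is (the image of) a sum of squares of polynomials in the
variables of `I`. [cite: Lasserre2006, Corollary 3.9 (3.15) (p. 11)] -/
def IsBlockSos (I : Set σ) (s : MvPolynomial σ ℝ) : Prop :=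
  ∃ q : MvPolynomial I ℝ, IsSumSq q ∧ s = rename ((↑) : I → σ) q

/-- [cite: Lasserre2006, Corollary 3.9 (3.15) (p. 11)] -/
theorem isBlockSos_zero (I : Set σ) : IsBlockSos I (0 : MvPolynomial σ ℝ) :=
  ⟨0, IsSumSq.zero, by simp⟩

/-- `rename` preserves sums of squares. [cite: Lasserre2006, Corollary 3.9 (3.15) (p. 11)] -/
theorem isSumSq_rename {τ : Type*} (k : τ → σ) {q : MvPolynomial τ ℝ} (h : IsSumSq q) :
    IsSumSq (rename k q) := by
  induction h with
  | zero => rw [map_zero]; exact IsSumSq.zero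
  | sq_add a hS ih =>
    rw [map_add, map_mul]
    exact IsSumSq.sq_add _ ih

/-- A block sum of squares is a sum of squares of `ℝ[X]` lying in `ℝ[X(I)]`.
[cite: Lasserre2006, Corollary 3.9 (3.15) (p. 11)] -/
theorem IsBlockSos.isSumSq_and_mem {I : Set σ} {s : MvPolynomial σ ℝ} (h : IsBlockSos I s) :
    IsSumSq s ∧ s ∈ supported ℝ I := by
  obtain ⟨q, hq, rfl⟩ := h
  exact ⟨isSumSq_rename _ hq, rename_mem_supported I q⟩

/-- The block ball polynomial `N − ‖X(I)‖² = N − Σ_{i ∈ I} X_i²` (Lasserre's (3.1)).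
[cite: Lasserre2006, (3.1) (p. 6) and Corollary 3.9] -/
def blockBall (I : Finset σ) (N : ℝ) : MvPolynomial σ ℝ := C N - ∑ i ∈ I, X i ^ 2

/-- [cite: Lasserre2006, (3.1) (p. 6)] -/
theorem eval_blockBall (I : Finset σ) (N : ℝ) (x : σ → ℝ) :
    eval x (blockBall I N) = N - ∑ i ∈ I, x i ^ 2 := by
  simp [blockBall, map_sum]

/-- The ball polynomial in the block's own ring renames to `blockBall`.
[cite: Lasserre2006, (3.1) (p. 6)] -/
theorem rename_ball_eq_blockBall (I : Finset σ) (N : ℝ) :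
    rename ((↑) : ↥(I : Set σ) → σ) (C N - ∑ v : ↥(I : Set σ), X v ^ 2) = blockBall I N := by
  rw [map_sub, rename_C, map_sum, blockBall]
  congr 1
  simp only [map_pow, rename_X]
  exact (Finset.sum_subtype I (fun _ => Iff.rfl) fun i => (X i : MvPolynomial σ ℝ) ^ 2).symm

/-- ★★ **Lasserre 2006, Corollary 3.9 — block-structured Putinar certificates with the redundant
ball constraints (3.1).** Blocks `I_1,…,I_p` (non-empty, running intersection property);
`f = Σ_j f_j` with `f_j ∈ ℝ[X(I_j)]`; constraints `g_k`, each in some `ℝ[X(I_j)]`; `N ∈ ℝ`.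
If `f > 0` on `{x | g_k(x) ≥ 0 ∀k, N − ‖x(I_j)‖² ≥ 0 ∀j}` then
`f = Σ_j ( s₀_j + Σ_k s_{jk} g_k + t_j (N − ‖X(I_j)‖²) )` with `s₀_j, s_{jk}, t_j` s.o.s. in
`ℝ[X(I_j)]` and `s_{jk} = 0` unless `g_k ∈ ℝ[X(I_j)]` (`k ∈ J_j`).  The block modules are
archimedean because they contain the ball constraints, so `sparse_putinar` applies with no
further hypothesis. [cite: Lasserre2006, Corollary 3.9 (p. 11) with (3.1)–(3.2) (pp. 6–7)] -/
theorem sparse_putinar_of_blockCover [Fintype σ] {p : ℕ} (I : Fin p → Finset σ)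
    (hI : ∀ j, (I j).Nonempty) (hRIP : IndexedRunningIntersection fun j => (I j : Set σ))
    (fb : Fin p → MvPolynomial σ ℝ) (hfb : ∀ j, fb j ∈ supported ℝ (I j : Set σ))
    {κ : Type*} [Fintype κ] (g : κ → MvPolynomial σ ℝ)
    (hg : ∀ k, ∃ j, g k ∈ supported ℝ (I j : Set σ)) (N : ℝ)
    (hpos : ∀ x : σ → ℝ, (∀ k, 0 ≤ eval x (g k)) → (∀ j, ∑ i ∈ I j, x i ^ 2 ≤ N) →
      0 < eval x (∑ j, fb j)) :
    ∃ (s₀ t : Fin p → MvPolynomial σ ℝ) (s : Fin p → κ → MvPolynomial σ ℝ),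
      (∀ j, IsBlockSos (I j : Set σ) (s₀ j)) ∧ (∀ j, IsBlockSos (I j : Set σ) (t j)) ∧
      (∀ j k, IsBlockSos (I j : Set σ) (s j k)) ∧
      (∀ j k, g k ∉ supported ℝ (I j : Set σ) → s j k = 0) ∧
      ∑ j, fb j = ∑ j, (s₀ j + ∑ k, s j k * g k + t j * blockBall (I j) N) := by
  classical
  -- pull the constraints back into the block rings (zero where a constraint is not in the block)
  have hpull : ∀ (j : Fin p) (k : κ), ∃ q : MvPolynomial ↥(I j : Set σ) ℝ,
      (g k ∈ supported ℝ (I j : Set σ) → rename ((↑) : ↥(I j : Set σ) → σ) q = g k) ∧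
      (g k ∉ supported ℝ (I j : Set σ) → q = 0) := by
    intro j k
    by_cases h : g k ∈ supported ℝ (I j : Set σ)
    · obtain ⟨q, hq⟩ := exists_eq_rename_of_mem_supported h
      exact ⟨q, fun _ => hq.symm, fun h' => absurd h h'⟩
    · exact ⟨0, fun h' => absurd h' h, fun _ => rfl⟩
  choose gq hgq_in hgq_out using hpull
  -- block generators: pulled-back constraints and the ball
  set gb : (j : Fin p) → κ ⊕ Unit → MvPolynomial ↥(I j : Set σ) ℝ :=
    fun j => Sum.elim (fun k => gq j k) fun _ => C N - ∑ v : ↥(I j : Set σ), X v ^ 2 with hgb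
  have hgb_inl : ∀ j k, rename ((↑) : ↥(I j : Set σ) → σ) (gb j (Sum.inl k)) =
      if g k ∈ supported ℝ (I j : Set σ) then g k else 0 := by
    intro j k
    simp only [hgb, Sum.elim_inl]
    split_ifs with h
    · exact hgq_in j k h
    · rw [hgq_out j k h, map_zero]
  have hgb_inr : ∀ j (u : Unit), rename ((↑) : ↥(I j : Set σ) → σ) (gb j (Sum.inr u)) =
      blockBall (I j) N := by
    intro j u
    simp only [hgb, Sum.elim_inr]
    exact rename_ball_eq_blockBall (I j) N
  -- archimedean: the ball constraint is a generator
  have hArch : ∀ j, IsArchimedeanModule (quadraticModule (gb j)) := by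
    intro j
    have hQ := isQuadraticModule_quadraticModule (gb j)
    refine ⟨⌈N⌉₊, ?_⟩
    have hsplit : (C (⌈N⌉₊ : ℝ) - ∑ v : ↥(I j : Set σ), X v ^ 2 : MvPolynomial ↥(I j : Set σ) ℝ) =
        C ((⌈N⌉₊ : ℝ) - N) + gb j (Sum.inr default) := by
      simp only [hgb, Sum.elim_inr, map_sub]
      ring
    rw [hsplit]
    refine hQ.2.1 _ (hQ.mem_of_isSumSq ?_) _ (mem_quadraticModule_gen _ _)
    have h0 : (0 : ℝ) ≤ (⌈N⌉₊ : ℝ) - N := sub_nonneg.2 (Nat.le_ceil N)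
    rw [show C ((⌈N⌉₊ : ℝ) - N) = C (Real.sqrt ((⌈N⌉₊ : ℝ) - N)) * C (Real.sqrt ((⌈N⌉₊ : ℝ) - N))
      by rw [← C_mul, Real.mul_self_sqrt h0]]
    exact IsSumSq.mul_self _
  -- positivity on the block-constrained set
  have hpos' : ∀ x : σ → ℝ, (∀ j i, 0 ≤ eval (fun v : ↥(I j : Set σ) => x v) (gb j i)) →
      0 < eval x (∑ j, fb j) := by
    intro x hx
    have hren : ∀ j i, eval (fun v : ↥(I j : Set σ) => x v) (gb j i) =
        eval x (rename ((↑) : ↥(I j : Set σ) → σ) (gb j i)) := by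
      intro j i
      rw [eval_rename]
      rfl
    refine hpos x (fun k => ?_) (fun j => ?_)
    · obtain ⟨j, hj⟩ := hg k
      have h := hx j (Sum.inl k)
      rwa [hren, hgb_inl, if_pos hj] at h
    · have h := hx j (Sum.inr default)
      rw [hren, hgb_inr, eval_blockBall] at h
      linarith
  obtain ⟨m, hm, hsum⟩ := sparse_putinar (fun j => (I j : Set σ)) (fun j => Finset.coe_nonempty.2 (hI j))
    hRIP gb hArch fb hfb hpos'
  -- unpack the block certificates
  have hunpack : ∀ j, ∃ (s₀ : MvPolynomial ↥(I j : Set σ) ℝ) (s : κ ⊕ Unit → MvPolynomial ↥(I j : Set σ) ℝ),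
      IsSumSq s₀ ∧ (∀ i, IsSumSq (s i)) ∧ m j = s₀ + ∑ i, s i * gb j i := fun j => hm j
  choose s₀ s hs₀ hs hms using hunpack
  refine ⟨fun j => rename ((↑) : ↥(I j : Set σ) → σ) (s₀ j),
    fun j => rename ((↑) : ↥(I j : Set σ) → σ) (s j (Sum.inr default)),
    fun j k => if g k ∈ supported ℝ (I j : Set σ) then
      rename ((↑) : ↥(I j : Set σ) → σ) (s j (Sum.inl k)) else 0,
    fun j => ⟨s₀ j, hs₀ j, rfl⟩, fun j => ⟨s j (Sum.inr default), hs j _, rfl⟩, fun j k => ?_,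
    fun j k hk => if_neg hk, ?_⟩
  · beta_reduce
    by_cases hk : g k ∈ supported ℝ (I j : Set σ)
    · rw [if_pos hk]
      exact ⟨s j (Sum.inl k), hs j _, rfl⟩
    · rw [if_neg hk]
      exact isBlockSos_zero _
  · rw [hsum]
    refine Finset.sum_congr rfl fun j _ => ?_
    have hk : ∀ k, rename ((↑) : ↥(I j : Set σ) → σ) (s j (Sum.inl k)) *
        rename ((↑) : ↥(I j : Set σ) → σ) (gb j (Sum.inl k)) =
        (if g k ∈ supported ℝ (I j : Set σ) then
          rename ((↑) : ↥(I j : Set σ) → σ) (s j (Sum.inl k)) else 0) * g k := by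
      intro k
      rw [hgb_inl]
      split_ifs
      · rfl
      · rw [mul_zero, zero_mul]
    rw [hms j, map_add, map_sum, Fintype.sum_sum_type]
    simp only [map_mul, hgb_inr, hk, Finset.univ_unique, Finset.sum_singleton]
    ring

/-! ### §5 The Waki–Lasserre pipeline: chordal extension of the csp graph ⇒ sparse certificate -/

/-- ★★ **From the csp graph to the certificate** [Waki–Kim–Kojima–Muramatsu 2006 §3.3, §4;
Lasserre 2006 (1.3), Cor. 3.9]. Let `G` be a chordal graph on the (non-empty, finite) set of
variables containing the csp graph of `(f, g)` — a «chordal extension of the csp graph» — and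
`N ∈ ℝ`.  If `f > 0` on `{x | g_k(x) ≥ 0 ∀k and ‖x(K)‖² ≤ N for every maximal clique K of G}`,
then the maximal cliques of `G` enumerate as `I_1,…,I_p` with the running intersection property,
`f = Σ_j f_j` with `f_j ∈ ℝ[X(I_j)]`, and
`f = Σ_j (s₀_j + Σ_k s_{jk} g_k + t_j (N − ‖X(I_j)‖²))` with all `s₀_j, s_{jk}, t_j` s.o.s. in
`ℝ[X(I_j)]`, `s_{jk} = 0` unless `g_k ∈ ℝ[X(I_j)]`.
[cite: WakiEtAl2006, §3.3 (p. 222), §4.1 (p. 224)] [cite: Lasserre2006, (1.3) p. 3 and Corollary 3.9 p. 11] -/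
theorem sparse_putinar_of_isChordal_csp [Fintype σ] [Nonempty σ] (f : MvPolynomial σ ℝ)
    {κ : Type*} [Fintype κ] (g : κ → MvPolynomial σ ℝ) {G : SimpleGraph σ} (hG : IsChordal G)
    (hcsp : cspGraph f g ≤ G) (N : ℝ)
    (hpos : ∀ x : σ → ℝ, (∀ k, 0 ≤ eval x (g k)) →
      (∀ K : Finset σ, Maximal G.IsClique (K : Set σ) → ∑ i ∈ K, x i ^ 2 ≤ N) → 0 < eval x f) :
    ∃ (p : ℕ) (I : Fin p → Finset σ) (fb s₀ t : Fin p → MvPolynomial σ ℝ)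
      (s : Fin p → κ → MvPolynomial σ ℝ),
      (∀ K : Set σ, Maximal G.IsClique K ↔ ∃ j, (I j : Set σ) = K) ∧
      IndexedRunningIntersection (fun j => (I j : Set σ)) ∧
      (∀ j, fb j ∈ supported ℝ (I j : Set σ)) ∧ ∑ j, fb j = f ∧
      (∀ j, IsBlockSos (I j : Set σ) (s₀ j)) ∧ (∀ j, IsBlockSos (I j : Set σ) (t j)) ∧
      (∀ j k, IsBlockSos (I j : Set σ) (s j k)) ∧
      (∀ j k, g k ∉ supported ℝ (I j : Set σ) → s j k = 0) ∧
      f = ∑ j, (s₀ j + ∑ k, s j k * g k + t j * blockBall (I j) N) := by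
  obtain ⟨p, I, hImax, hRIP⟩ := exists_maximalCliques_runningIntersection hG
  have hcover : IsBlockCover f g I :=
    IsBlockCover.of_maximalCliques hcsp fun K hK => (hImax K).1 hK
  obtain ⟨⟨fb, hfb, hsumf⟩, hgb⟩ := hcover.exists_sum_eq
  have hI : ∀ j, (I j).Nonempty := by
    intro j
    have hmax : Maximal G.IsClique (I j : Set σ) := (hImax _).2 ⟨j, rfl⟩
    obtain ⟨v, hv⟩ := nonempty_of_maximal_isClique hmax
    exact ⟨v, Finset.mem_coe.1 hv⟩
  have hpos' : ∀ x : σ → ℝ, (∀ k, 0 ≤ eval x (g k)) → (∀ j, ∑ i ∈ I j, x i ^ 2 ≤ N) →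
      0 < eval x (∑ j, fb j) := by
    intro x hxg hxb
    rw [hsumf]
    refine hpos x hxg fun K hK => ?_
    obtain ⟨j, hj⟩ := (hImax K).1 hK
    rw [Finset.coe_inj] at hj
    rw [← hj]
    exact hxb j
  obtain ⟨s₀, t, s, hs₀, ht, hs, hsz, hcert⟩ :=
    sparse_putinar_of_blockCover I hI hRIP fb hfb g hgb N hpos'
  exact ⟨p, I, fb, s₀, t, s, hImax, hRIP, hfb, hsumf, hs₀, ht, hs, hsz, hsumf.symm.trans hcert⟩

end Literature.Algebra.Polynomial.CorrelativeSparsityCertificates
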